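import Summits.HodgeConjecture.HodgeConjecture.Theorems.NikulinTwinTransportRealMultiplicationCore

/-!
# Route NikulinTwinTransport · `SquareHodgeOfSqrtTwo` (stmt-HodgeConjecture-13680) —
# the rational core: Hodge endomorphisms of `Λ_ℚ` on the `√2`-sector

Item stmt-HodgeConjecture-13680 (`SquareHodgeOfSqrtTwo`, THE SECTOR of route NikulinTwinTransport):
`HodgeConjectureFor 4 (S ⊗ S)` for every projective K3 surface `S` carrying a rational,
type-preserving, cup-self-adjoint `e` killing `NS := algebraicClasses S 1` with `e² = 2` on `NS^⊥`
and `End_Hdg(NS^⊥) ⊆ ℚ + ℚe`. Standalone this is an open sub-case of the Hodge conjecture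
(VanGeemenSchuett2023: the inducing cycle of real multiplication is unknown); in the route it closes
through `SquareGlue : RealMultiplicationSqrtTwoAlgebraic → LefschetzOneOneK3 → SquareHodgeOfSqrtTwo`,
the Künneth bookkeeping (Varesco 2023, p. 8: "proving the Hodge conjecture for `X²` is equivalent to
showing that every element of `End_Hdg(T(X))` is algebraic"). The mathematical heart of that
bookkeeping — `Hom_Hdg(T, NS) = Hom_Hdg(NS, T) = 0` and `End_Hdg(H²) = End(NS) ⊕ End_Hdg(T)` — is
proved here as PURE LINEAR ALGEBRA over `ℚ`, in the coordinates `Λ_ℚ ⊂ Λ_ℂ` of a marking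
(sibling files transfer it to `H²(S(ℂ); ℂ)` and to the route decls):

* `ratEnd_normalForm`: let `N ≤ Λ_ℚ` (the rational divisor classes), `ε ∈ End(Λ_ℚ)` with
  `ε|_N = 0`, `ε² = 2` on `T := N^⊥` (real multiplication), and `x₀ ∈ Λ_ℂ` (the period) be such that
  `N ⊥ x₀` (divisors are `(1,1)`), rational vectors orthogonal to `x₀` lie in `N` (Lefschetz `(1,1)`),
  and every rational `φ` whose complexification fixes `ℂx₀` and preserves `{x₀, x̄₀}^⊥`, killing `N`
  with image in `T`, is `a + bε` on `T` (`End_Hdg(T) ⊆ ℚ + ℚe`). Then every rational `G` whose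
  complexification fixes `ℂx₀` and preserves `{x₀, x̄₀}^⊥` is
  `G u = Σᵢ (u.aᵢ) bᵢ + α u + β ε u` with `aᵢ, bᵢ ∈ N`, `α, β ∈ ℚ`.
  The proof is the adjoint argument: for `n ∈ N` the functional `u ↦ (n . P G u)` (`P` the
  projection onto `N` along `T`, which exists because `ε` forces `N ∩ T = 0`) is `(w . ·)` for a
  RATIONAL `w` with `(w . x₀) = 0`, hence `w ∈ N` kills `T` — so `G(T) ⊆ T`; symmetrically the
  `T`-component of `G n` is rational and orthogonal to `x₀`, so `G(N) ⊆ N`; the `T`-`T` block is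
  `a + bε` by hypothesis and the `N`-`N` block is a sum of rank-one maps (`exists_eq_sum_rankOne`).
* small lemmas on `Λ_ℚ ⊂ Λ_ℂ`: `ℂ`-linear maps agreeing on `Λ_ℚ` agree (`eq_of_forall_ratCast`),
  complexifications are defined over `ℚ` (`forall_intCast_of_complexification`), rational vectors are
  real, and a rational vector orthogonal to `x₀` is orthogonal to `x̄₀`.

No named fact is used here. Sources for the mathematics: Huybrechts, *Lectures on K3 Surfaces*
Ch. 3 (Lemma 3.1: `T` is an irreducible Hodge structure for projective K3; §3.2–3.3:
`End_Hdg(T)` is a field, totally real or CM — Zarhin 1983); Varesco, Math. Z. 305 (2023) p. 8.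
Prover seat prover-pitem-stmt-HodgeConjecture-13680-0.
-/

noncomputable section

namespace Summit.HodgeConjecture.HodgeConjecture.Theorems.NikulinTwinTransport

open scoped Manifold
open Module CategoryTheory MonoidalCategory
open Literature.AlgebraicGeometry.Motives Literature.AlgebraicGeometry.HodgeTheory
open Literature.AlgebraicGeometry.Surfaces Literature.Geometry.Kaehler
open Literature.AlgebraicTopology.SingularHomology

/-! ### `Λ_ℚ ⊂ Λ_ℂ`: complexifications of rational endomorphisms -/

/-- Two `ℂ`-linear maps on `Λ_ℂ` that agree on `Λ_ℚ` are equal (the rational standard basis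
spans `Λ_ℂ`). [folklore] -/
theorem eq_of_forall_ratCast {M : Type*} [AddCommGroup M] [Module ℂ M]
    {Φ Ψ : (K3Index → ℂ) →ₗ[ℂ] M}
    (h : ∀ u : K3Index → ℚ, Φ (fun i => (u i : ℂ)) = Ψ (fun i => (u i : ℂ))) : Φ = Ψ := by
  refine (Pi.basisFun ℂ K3Index).ext fun j => ?_
  rw [basisFun_eq_ratCastΛ]
  exact h _

/-- A complexification is defined over `ℚ` in the sense used for markings: it maps `Λ` into
`Λ_ℚ`. [folklore] -/
theorem forall_intCast_of_complexification {φ : Module.End ℚ (K3Index → ℚ)}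
    {Φ : Module.End ℂ (K3Index → ℂ)}
    (hΦ : ∀ u : K3Index → ℚ, Φ (fun i => (u i : ℂ)) = fun i => (φ u i : ℂ)) (v : K3Index → ℤ) :
    ∃ w : K3Index → ℚ, Φ (fun i => (v i : ℂ)) = fun i => (w i : ℂ) :=
  ⟨φ fun i => (v i : ℚ), by rw [intCast_eq_ratCast_intCast, hΦ]⟩

/-- Rational vectors of `Λ_ℂ` are real. [folklore] -/
theorem star_ratCastΛ (u : K3Index → ℚ) : star (fun i => (u i : ℂ)) = fun i => (u i : ℂ) := by
  funext i
  simp only [Pi.star_apply, star_ratCast]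

/-- `Λ_ℚ ⊂ Λ_ℂ` is compatible with subtraction. [folklore] -/
theorem ratCastΛ_sub (u v : K3Index → ℚ) :
    (fun i => ((u - v) i : ℂ)) = (fun i => (u i : ℂ)) - fun i => (v i : ℂ) := by
  funext i; simp only [Pi.sub_apply, Rat.cast_sub]

/-- A rational vector orthogonal to `x₀` is orthogonal to `x̄₀` (the K3 form is real).
[folklore] -/
theorem k3Form_ratCast_star_eq_zero {u : K3Index → ℚ} {x : K3Index → ℂ}
    (h : k3Form (fun i => (u i : ℂ)) x = 0) : k3Form (fun i => (u i : ℂ)) (star x) = 0 := by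
  have h' := star_k3Form (fun i => (u i : ℂ)) x
  rw [star_ratCastΛ, h, star_zero] at h'
  exact h'.symm

/-- The K3 form is additive over finite sums in the first variable. [folklore] -/
theorem k3Form_sum_left {ι : Type*} (s : Finset ι) (f : ι → K3Index → ℂ) (b : K3Index → ℂ) :
    k3Form (∑ i ∈ s, f i) b = ∑ i ∈ s, k3Form (f i) b := by
  rw [← k3FormC_apply, map_sum, LinearMap.sum_apply]
  simp only [k3FormC_apply]

/-- The K3 form is compatible with subtraction in the first variable. [folklore] -/
theorem k3Form_sub_left (a a' b : K3Index → ℂ) : k3Form (a - a') b = k3Form a b - k3Form a' b := by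
  rw [← k3FormC_apply, map_sub, LinearMap.sub_apply, k3FormC_apply, k3FormC_apply]

/-! ### The rational core: Hodge endomorphisms of `Λ_ℚ` on the `√2`-sector -/

/-- If `ε` kills `N` and `ε² = 2` on `N^⊥`, then `N ∩ N^⊥ = 0`, so `Λ_ℚ = N ⊕ N^⊥`. [folklore] -/
theorem isCompl_orthogonal_of_sq (NQ : Submodule ℚ (K3Index → ℚ)) (ε : Module.End ℚ (K3Index → ℚ))
    (hεN : ∀ u ∈ NQ, ε u = 0)
    (hεT : ∀ u ∈ k3FormRat.orthogonal NQ, ε (ε u) = (2 : ℚ) • u) :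
    IsCompl NQ (k3FormRat.orthogonal NQ) := by
  refine (LinearMap.BilinForm.isCompl_orthogonal_iff_disjoint k3FormRat_isSymm.isRefl).2 ?_
  rw [Submodule.disjoint_def]
  intro n hn hnT
  have h1 : ε (ε n) = (2 : ℚ) • n := hεT n hnT
  rw [hεN n hn, map_zero] at h1
  exact (smul_eq_zero.1 h1.symm).resolve_left two_ne_zero


/-- **Hodge endomorphisms of `Λ_ℚ` on the `√2`-sector: the normal form.** Data: a subspace
`N ≤ Λ_ℚ` ("`NS_ℚ`"), an endomorphism `ε` killing `N` with `ε² = 2` on `T := N^⊥` ("real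
multiplication"), and a vector `x₀ ∈ Λ_ℂ` ("the period"), such that `N ⊥ x₀` (divisors are
`(1,1)`), every rational vector orthogonal to `x₀` lies in `N` (Lefschetz `(1,1)`), and every
rational endomorphism `φ` whose complexification fixes the line `ℂx₀` and preserves
`{x₀, x̄₀}^⊥`, killing `N` with image in `T`, is `a + bε` on `T` (`End_Hdg(T) = ℚ + ℚe`). Then every
rational `G` whose complexification `Γ` fixes `ℂx₀` and preserves `{x₀, x̄₀}^⊥` (a Hodge
endomorphism) is `G u = Σᵢ (u.aᵢ) bᵢ + α u + β ε u` with `aᵢ, bᵢ ∈ N`, `α, β ∈ ℚ`. Proof: with the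
projection `P` onto `N` along `T`, (i) `G(T) ⊆ T` — for `n ∈ N` the functional `u ↦ (n.PGu)` is
`(w.·)` with `w` rational and `(w.x₀) = (n.PΓx₀) = 0`, so `w ∈ N` and it kills `T`; (ii)
`G(N) ⊆ N` — the `T`-component of `Gn` is rational and orthogonal to `x₀`; (iii) `(1-P)G(1-P)` is
`a(1-P) + bε` by hypothesis; (iv) `PGP - aP` has image in `N` and kills `T`, hence is a sum of
rank-one maps `u ↦ (u.aᵢ) bᵢ` (`exists_eq_sum_rankOne`). [cite: Huybrechts2016K3, Ch. 3 Lemma 3.3.1 and Thm. 3.3.7]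
[cite: Zarhin1983HodgeGroupsK3, Thm. 1.5.1] -/
theorem ratEnd_normalForm (NQ : Submodule ℚ (K3Index → ℚ)) (ε : Module.End ℚ (K3Index → ℚ))
    (x₀ : K3Index → ℂ)
    (hN11 : ∀ u ∈ NQ, k3Form (fun i => (u i : ℂ)) x₀ = 0)
    (hL11 : ∀ u : K3Index → ℚ, k3Form (fun i => (u i : ℂ)) x₀ = 0 → u ∈ NQ)
    (hεN : ∀ u ∈ NQ, ε u = 0)
    (hεT : ∀ u ∈ k3FormRat.orthogonal NQ, ε (ε u) = (2 : ℚ) • u)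
    (hEnd : ∀ (φ : Module.End ℚ (K3Index → ℚ)) (Φ : Module.End ℂ (K3Index → ℂ)),
      (∀ u : K3Index → ℚ, Φ (fun i => (u i : ℂ)) = fun i => (φ u i : ℂ)) →
      (∃ t : ℂ, Φ x₀ = t • x₀) →
      (∀ y, k3Form y x₀ = 0 → k3Form y (star x₀) = 0 →
        k3Form (Φ y) x₀ = 0 ∧ k3Form (Φ y) (star x₀) = 0) →
      (∀ u ∈ NQ, φ u = 0) → (∀ u, φ u ∈ k3FormRat.orthogonal NQ) →
      ∃ a b : ℚ, ∀ u ∈ k3FormRat.orthogonal NQ, φ u = a • u + b • ε u)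
    (G : Module.End ℚ (K3Index → ℚ)) (Γ : Module.End ℂ (K3Index → ℂ))
    (hΓ : ∀ u : K3Index → ℚ, Γ (fun i => (u i : ℂ)) = fun i => (G u i : ℂ))
    (hΓ20 : ∃ t : ℂ, Γ x₀ = t • x₀)
    (hΓ11 : ∀ y, k3Form y x₀ = 0 → k3Form y (star x₀) = 0 →
      k3Form (Γ y) x₀ = 0 ∧ k3Form (Γ y) (star x₀) = 0) :
    ∃ (m : ℕ) (a b : Fin m → K3Index → ℚ) (α β : ℚ), (∀ i, a i ∈ NQ) ∧ (∀ i, b i ∈ NQ) ∧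
      ∀ u, G u = ∑ i, k3FormRat u (a i) • b i + α • u + β • ε u := by
  classical
  have hBs : k3FormRat.IsSymm := k3FormRat_isSymm
  have hBn : k3FormRat.Nondegenerate := k3FormRat_nondegenerate
  set T := k3FormRat.orthogonal NQ with hTdef
  have hc : IsCompl NQ T := isCompl_orthogonal_of_sq NQ ε hεN hεT
  have hN11' : ∀ u ∈ NQ, k3Form (fun i => (u i : ℂ)) (star x₀) = 0 := fun u hu =>
    k3Form_ratCast_star_eq_zero (hN11 u hu)
  have hNT : ∀ n ∈ NQ, ∀ t ∈ T, k3FormRat n t = 0 := fun n hn t ht =>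
    (LinearMap.BilinForm.mem_orthogonal_iff.1 ht) n hn
  -- the projection onto `N` along `T`, and its expansion in rank-one maps
  set P := NQ.projection T hc with hPdef
  have hPN : ∀ u, P u ∈ NQ := fun u => Submodule.projection_apply_mem hc u
  have hPT : ∀ t ∈ T, P t = 0 := fun t ht => Submodule.projection_apply_right hc ⟨t, ht⟩
  have hPleft : ∀ n ∈ NQ, P n = n := fun n hn => Submodule.projection_apply_of_mem_left hc hn
  have hsubT : ∀ u, u - P u ∈ T := fun u => Submodule.sub_projection_mem hc u
  obtain ⟨m₀, n', n, hn', hn, hPsum⟩ := exists_eq_sum_rankOne hBs hBn NQ P hPN hPT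
  -- the complexification `Pc` of `P`, written out
  set Pc : Module.End ℂ (K3Index → ℂ) :=
    ∑ i, (k3FormC.flip fun j => (n' i j : ℂ)).smulRight (fun j => (n i j : ℂ)) with hPcdef
  have hPcapply : ∀ y, Pc y = ∑ i, k3Form y (fun j => (n' i j : ℂ)) • fun j => (n i j : ℂ) := by
    intro y
    rw [hPcdef, LinearMap.sum_apply]
    refine Finset.sum_congr rfl fun i _ => ?_
    rw [LinearMap.smulRight_apply, LinearMap.BilinForm.flip_apply, k3FormC_apply]
  have hPcrat : ∀ u : K3Index → ℚ, Pc (fun i => (u i : ℂ)) = fun i => (P u i : ℂ) := by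
    intro u
    rw [hPcapply, hPsum u, ratCastΛ_sum]
    refine Finset.sum_congr rfl fun i _ => ?_
    rw [ratCastΛ_smul, k3Form_ratCast]
  have hPcx₀ : Pc x₀ = 0 := by
    rw [hPcapply]
    refine Finset.sum_eq_zero fun i _ => ?_
    rw [k3Form_comm, hN11 _ (hn' i), zero_smul]
  have hPcorth1 : ∀ y, k3Form (Pc y) x₀ = 0 := fun y => by
    rw [hPcapply, k3Form_sum_left]
    refine Finset.sum_eq_zero fun i _ => ?_
    rw [k3Form_smul_left, hN11 _ (hn i), mul_zero]
  have hPcorth2 : ∀ y, k3Form (Pc y) (star x₀) = 0 := fun y => by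
    rw [hPcapply, k3Form_sum_left]
    refine Finset.sum_eq_zero fun i _ => ?_
    rw [k3Form_smul_left, hN11' _ (hn i), mul_zero]
  obtain ⟨t₀, ht₀⟩ := hΓ20
  -- (i) `G(T) ⊆ T`
  have hGT : ∀ t ∈ T, G t ∈ T := by
    intro t ht
    rw [hTdef, LinearMap.BilinForm.mem_orthogonal_iff]
    intro nn hnn
    -- the functional `u ↦ (nn . P (G u))` is `(w . ·)` for a rational `w`, and `w ∈ N`
    set lam : Module.Dual ℚ (K3Index → ℚ) := (k3FormRat nn) ∘ₗ P ∘ₗ G with hlam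
    set w := (k3FormRat.toDual hBn).symm lam with hw
    have hBw : ∀ u, k3FormRat w u = k3FormRat nn (P (G u)) := fun u => by
      rw [hw, LinearMap.BilinForm.apply_toDual_symm_apply]
      rfl
    have hwx : k3Form (fun i => (w i : ℂ)) x₀ = 0 := by
      have hℓ : (k3FormC fun i => (w i : ℂ)) - (k3FormC fun i => (nn i : ℂ)) ∘ₗ Pc ∘ₗ Γ = 0 := by
        refine eq_of_forall_ratCast fun u => ?_
        rw [LinearMap.zero_apply, LinearMap.sub_apply, LinearMap.comp_apply, LinearMap.comp_apply,
          hΓ, hPcrat, k3FormC_apply, k3FormC_apply, k3Form_ratCast, k3Form_ratCast, hBw, sub_self]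
      have h := LinearMap.congr_fun hℓ x₀
      rw [LinearMap.sub_apply, LinearMap.comp_apply, LinearMap.comp_apply, ht₀, map_smul, hPcx₀,
        smul_zero, k3FormC_apply, k3FormC_apply, k3Form_zero_right, sub_zero,
        LinearMap.zero_apply] at h
      exact h
    have hwN : w ∈ NQ := hL11 w hwx
    have h0 : k3FormRat nn (P (G t)) = 0 := by
      rw [← hBw]
      exact hNT w hwN t ht
    have hsplit : G t = P (G t) + (G t - P (G t)) := by abel
    rw [hsplit, map_add, h0, zero_add]
    exact hNT nn hnn _ (hsubT (G t))
  -- (ii) `G(N) ⊆ N`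
  have hGN : ∀ nn ∈ NQ, G nn ∈ NQ := by
    intro nn hnn
    have hdiff : G nn - P (G nn) ∈ NQ := by
      apply hL11
      rw [ratCastΛ_sub, ← hPcrat, ← hΓ, k3Form_sub_left, hPcorth1, sub_zero]
      exact (hΓ11 _ (hN11 nn hnn) (hN11' nn hnn)).1
    have hzero : G nn - P (G nn) = 0 :=
      (Submodule.disjoint_def.1 hc.disjoint) _ hdiff (hsubT (G nn))
    rw [sub_eq_zero.1 hzero]
    exact hPN _
  -- (iii) the `T`-`T` block: `(1 - P) G (1 - P)` is `a(1 - P) + b ε`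
  set Q : Module.End ℚ (K3Index → ℚ) := LinearMap.id - P with hQdef
  have hQapply : ∀ u, Q u = u - P u := fun u => rfl
  have hQT : ∀ u, Q u ∈ T := fun u => hsubT u
  have hQN : ∀ nn ∈ NQ, Q nn = 0 := fun nn hnn => by rw [hQapply, hPleft nn hnn, sub_self]
  set φ : Module.End ℚ (K3Index → ℚ) := Q ∘ₗ G ∘ₗ Q with hφdef
  set Φ : Module.End ℂ (K3Index → ℂ) := (LinearMap.id - Pc) ∘ₗ Γ ∘ₗ (LinearMap.id - Pc) with hΦdef
  have hΦrat : ∀ u : K3Index → ℚ, Φ (fun i => (u i : ℂ)) = fun i => (φ u i : ℂ) := by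
    intro u
    simp only [hΦdef, hφdef, LinearMap.comp_apply, LinearMap.sub_apply, LinearMap.id_apply]
    rw [hPcrat, ← ratCastΛ_sub, ← hQapply, hΓ, hPcrat, ← ratCastΛ_sub, hQapply (G (Q u))]
  have hΦ20 : ∃ t : ℂ, Φ x₀ = t • x₀ := by
    refine ⟨t₀, ?_⟩
    simp only [hΦdef, LinearMap.comp_apply, LinearMap.sub_apply, LinearMap.id_apply]
    rw [hPcx₀, sub_zero, ht₀, map_smul, hPcx₀, smul_zero, sub_zero]
  have hsub11 : ∀ y, k3Form y x₀ = 0 → k3Form y (star x₀) = 0 →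
      k3Form (y - Pc y) x₀ = 0 ∧ k3Form (y - Pc y) (star x₀) = 0 := fun y hy1 hy2 =>
    ⟨by rw [k3Form_sub_left, hy1, hPcorth1, sub_zero], by rw [k3Form_sub_left, hy2, hPcorth2, sub_zero]⟩
  have hΦ11 : ∀ y, k3Form y x₀ = 0 → k3Form y (star x₀) = 0 →
      k3Form (Φ y) x₀ = 0 ∧ k3Form (Φ y) (star x₀) = 0 := by
    intro y hy1 hy2
    simp only [hΦdef, LinearMap.comp_apply, LinearMap.sub_apply, LinearMap.id_apply]
    obtain ⟨h1, h2⟩ := hsub11 y hy1 hy2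
    obtain ⟨h3, h4⟩ := hΓ11 _ h1 h2
    exact hsub11 _ h3 h4
  have hφN : ∀ u ∈ NQ, φ u = 0 := fun u hu => by
    simp only [hφdef, LinearMap.comp_apply]
    rw [hQN u hu, map_zero, map_zero]
  have hφT : ∀ u, φ u ∈ T := fun u => hQT _
  obtain ⟨a, b, hab⟩ := hEnd φ Φ hΦrat hΦ20 hΦ11 hφN hφT
  -- `φ u = a u - a P u + b ε u` for every `u`
  have hQQ : ∀ u, Q (Q u) = Q u := fun u => by
    rw [hQapply (Q u), hPT _ (hQT u), sub_zero]
  have hεP : ∀ u, ε (P u) = 0 := fun u => hεN _ (hPN u)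
  have hφall : ∀ u, φ u = a • u - a • P u + b • ε u := by
    intro u
    have h1 : φ u = φ (Q u) := by
      simp only [hφdef, LinearMap.comp_apply, hQQ]
    rw [h1, hab _ (hQT u), hQapply, map_sub, hεP, sub_zero, smul_sub]
  -- (iv) the `N`-`N` block minus `a P` is a sum of rank-one maps
  set g₀ : Module.End ℚ (K3Index → ℚ) := P ∘ₗ G ∘ₗ P - a • P with hg₀def
  have hg₀apply : ∀ u, g₀ u = P (G (P u)) - a • P u := fun u => rfl
  have hg₀N : ∀ u, g₀ u ∈ NQ := fun u => by
    rw [hg₀apply]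
    exact NQ.sub_mem (hPN _) (NQ.smul_mem _ (hPN u))
  have hg₀T : ∀ t ∈ T, g₀ t = 0 := fun t ht => by
    rw [hg₀apply, hPT t ht, map_zero, map_zero, smul_zero, sub_zero]
  obtain ⟨m, a', b', ha', hb', hg₀⟩ := exists_eq_sum_rankOne hBs hBn NQ g₀ hg₀N hg₀T
  refine ⟨m, a', b', a, b, ha', hb', fun u => ?_⟩
  -- assemble: `G u = G (P u) + G (Q u)`, `G (P u) = P G P u`, `G (Q u) = φ u`
  have hGP : G (P u) = P (G (P u)) := (hPleft _ (hGN _ (hPN u))).symm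
  have hGQ : G (Q u) = φ u := by
    have hmem : G (Q u) ∈ T := hGT _ (hQT u)
    simp only [hφdef, LinearMap.comp_apply]
    rw [hQapply (G (Q u)), hPT _ hmem, sub_zero]
  have hu : u = P u + Q u := by rw [hQapply]; abel
  rw [← hg₀, hg₀apply]
  conv_lhs => rw [hu, map_add, hGP, hGQ, hφall]
  abel



end Summit.HodgeConjecture.HodgeConjecture.Theorems.NikulinTwinTransport

end
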